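import Summits.Ventures.Crystal3D.Theorems.StickyWulffConstantTextureLiminfCubeRigidityLayerSteps
import HarnessLib

/-!
# Cube rigidity II — the LOCAL Barlow stacking: layer upon layer on shrinking discs, local no-room, local Hales §1.3
# (lane T, crux `TextureLiminf`, stmt-Ventures-19483; registered line `TexShadow`, named core `CubeRigidity` of `stub_resolution`)

HONEST FRAMING. Venture `Summits/Ventures/Crystal3D` (cell `crystal3d-full`), helper `--supports` the crux `TextureLiminf`
(stmt-Ventures-19483) of `route-Ventures-StickyWulffConstant`, registered line `TexShadow`.  Rung credit only; F-C1 not moved.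
Second brick of the kernel proof of `CubeRigidity`: Hales's normalisation, frame `u₁ u₂ w h e₃`.

* `exists_local_stacking` — from a base-layer datum `LayerDisc V 0 σ σ' n` and FCC/HCP tangent arrangements within `2n + 2` of
  the origin, a Hägg word `s` with `barlowPos 2 h s k i j ∈ V` for all sites `|i| + |j| ≤ n − 2|k|` (the two `ℕ`-recursions of
  `LayerStackings.exists_barlowStacking_subset`, run on discs shrinking by `2` per layer, with `layerDisc_up` / `layerDisc_down`).
* `abs_haggLabel_le`, `exists_site_near` — LOCAL NO-ROOM: every point `x` is within distance `< 2` of a site `(k, i, j)` with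
  `|k| ≤ ‖x‖ + 2`, `|i| + |j| ≤ 4(‖x‖ + 2)` (`exists_dist_barlowPos_lt_two` + coordinate bounds).
* `local_layerPackings` — LOCAL HALES §1.3: under the same hypotheses with `6(R + 2) ≤ n`, every centre of `V` within `R` of the
  origin is a point of `barlowStacking 2 h s`; `local_layerPackings_hcp` / `local_layerPackings_fcc` supply the base-layer datum
  from an HCP-type centre (`layerDisc_hcp`) / from an all-FCC ball (`layerDisc_fcc`).
WHAT THIS IS NOT: not yet `CubeRigidity` (file III: frames, the case split, the doubling bridge); F-C1 not moved.
-/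

noncomputable section

namespace Summit.Ventures.Crystal3D.Theorems.LocalStacking

open Literature.Geometry.DiscreteGeometry Literature.MathematicalPhysics.StatisticalMechanics
open RealInnerProductSpace Summit.Ventures.Crystal3D.L2B


variable {V : Set (EuclideanSpace ℝ (Fin 3))}

/-! ## Small facts -/

/-- `‖τ w + h e₃‖ = 2` for a sign `τ`. -/
theorem norm_sign_smul_frameW_add_frameE {τ : ℝ} (hτ : τ = 1 ∨ τ = -1) : ‖τ • (barlowOffset (2 : ℝ)) + layerNormal layerSpacing‖ = 2 := by
  rw [norm_eq_two_iff_inner]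
  have hτ2 : τ * τ = 1 := by rcases hτ with rfl | rfl <;> norm_num
  simp only [inner_add_left, inner_add_right, inner_smul_left, inner_smul_right, inner_frameW_frameW,
    inner_frameW_frameE, inner_frameE_frameW, inner_frameE_frameE, RCLike.conj_to_real]
  nlinarith [hτ2]

/-- `‖τ w − h e₃‖ = 2` for a sign `τ`. -/
theorem norm_sign_smul_frameW_sub_frameE {τ : ℝ} (hτ : τ = 1 ∨ τ = -1) : ‖τ • (barlowOffset (2 : ℝ)) - layerNormal layerSpacing‖ = 2 := by
  rw [norm_eq_two_iff_inner]
  have hτ2 : τ * τ = 1 := by rcases hτ with rfl | rfl <;> norm_num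
  simp only [inner_sub_left, inner_sub_right, inner_smul_left, inner_smul_right, inner_frameW_frameW,
    inner_frameW_frameE, inner_frameE_frameW, inner_frameE_frameE, RCLike.conj_to_real]
  nlinarith [hτ2]

/-- `barlowPos 2 h s k i j = latPt i j + (haggLabel s k) w + k h e₃`. -/
theorem barlowPos_eq_latPt (s : ℤ → ℤ) (k i j : ℤ) :
    barlowPos 2 layerSpacing s k i j = latPt i j + ((haggLabel s k : ℝ) • (barlowOffset (2 : ℝ)) + (k : ℝ) • layerNormal layerSpacing) := by
  simp only [barlowPos, latPt]; abel

/-- `|haggLabel s k| ≤ |k|` for a Hägg sequence. -/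
theorem abs_haggLabel_le {s : ℤ → ℤ} (hs : IsHaggSeq s) (k : ℤ) : |haggLabel s k| ≤ |k| := by
  have h1 : ∀ m, |s m| = 1 := fun m => by rcases hs m with h | h <;> simp [h]
  induction k using Int.induction_on with
  | zero => simp
  | succ n ih =>
    rw [haggLabel_succ]
    calc |haggLabel s n + s n| ≤ |haggLabel s n| + |s n| := abs_add_le _ _
      _ ≤ |(n : ℤ)| + 1 := by rw [h1]; exact add_le_add ih le_rfl
      _ = |(n : ℤ) + 1| := by rw [abs_of_nonneg (by positivity), abs_of_nonneg (by positivity)]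
  | pred n ih =>
    have e : haggLabel s (-(n : ℤ) - 1) = haggLabel s (-(n : ℤ)) - s (-(n : ℤ) - 1) := by
      have := haggLabel_succ s (-(n : ℤ) - 1); rw [sub_add_cancel] at this; linarith
    rw [e]
    calc |haggLabel s (-(n : ℤ)) - s (-(n : ℤ) - 1)| ≤ |haggLabel s (-(n : ℤ))| + |s (-(n : ℤ) - 1)| := abs_sub _ _
      _ ≤ |(-(n : ℤ))| + 1 := by rw [h1]; exact add_le_add ih le_rfl
      _ = |(-(n : ℤ)) - 1| := by
          rw [abs_of_nonpos (by omega), abs_of_nonpos (by omega)]; ring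

/-! ## The local stacking -/

/-- **Layer upon layer, locally.** If the origin's layer is present to ℓ¹-radius `n` with shells `layerShell σ σ'` and every
centre of `V` within `2n + 2` of the origin has an FCC or HCP tangent arrangement, then for a Hägg word `s` (the letter shifts
read off the packing layer by layer) every site `(k, i, j)` with `|i| + |j| ≤ n − 2|k|` of `barlowStacking 2 h s` is a centre
of `V`. -/
theorem exists_local_stacking (hV : IsUnitBallPacking V) {σ σ' : ℝ} (hσ : σ = 1 ∨ σ = -1) (hσ' : σ' = 1 ∨ σ' = -1)
    {n : ℤ} (hL : LayerDisc V 0 σ σ' n)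
    (hcp : ∀ u ∈ V, ‖u‖ ≤ 2 * n + 2 → IsArrangedIn (kissingShell V u) fccKissingPattern ∨
      IsArrangedIn (kissingShell V u) hcpKissingPattern) :
    ∃ s : ℤ → ℤ, IsHaggSeq s ∧ ∀ k i j : ℤ, |i| + |j| ≤ n - 2 * |k| → barlowPos 2 layerSpacing s k i j ∈ V := by
  classical
  -- type detectors
  let upT : (EuclideanSpace ℝ (Fin 3)) → ℤ := fun c => if c + (barlowOffset (2 : ℝ) + layerNormal layerSpacing) ∈ V then 1 else -1
  let dnT : (EuclideanSpace ℝ (Fin 3)) → ℤ := fun c => if c + (barlowOffset (2 : ℝ) - layerNormal layerSpacing) ∈ V then 1 else -1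
  have upT_sign : ∀ c, ((upT c : ℤ) : ℝ) = 1 ∨ ((upT c : ℤ) : ℝ) = -1 := fun c => by
    simp only [upT]; split_ifs <;> simp
  have dnT_sign : ∀ c, ((dnT c : ℤ) : ℝ) = 1 ∨ ((dnT c : ℤ) : ℝ) = -1 := fun c => by
    simp only [dnT]; split_ifs <;> simp
  have upT_int : ∀ c, upT c = 1 ∨ upT c = -1 := fun c => by simp only [upT]; split_ifs <;> simp
  have dnT_int : ∀ c, dnT c = 1 ∨ dnT c = -1 := fun c => by simp only [dnT]; split_ifs <;> simp
  have upT_eq : ∀ {c : (EuclideanSpace ℝ (Fin 3))} {ρ ρ' : ℝ}, (ρ = 1 ∨ ρ = -1) → kissingShell V c = layerShell ρ ρ' →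
      ((upT c : ℤ) : ℝ) = ρ := by
    intro c ρ ρ' hρ h; rw [upper_type_eq hρ h]; simp only [upT]; split_ifs <;> simp
  have dnT_eq : ∀ {c : (EuclideanSpace ℝ (Fin 3))} {ρ ρ' : ℝ}, (ρ' = 1 ∨ ρ' = -1) → kissingShell V c = layerShell ρ ρ' →
      ((dnT c : ℤ) : ℝ) = ρ' := by
    intro c ρ ρ' hρ' h; rw [lower_type_eq hρ' h]; simp only [dnT]; split_ifs <;> simp
  -- arrangements near a base of controlled norm
  have cpAt : ∀ (c : (EuclideanSpace ℝ (Fin 3))) (m : ℕ), ‖c‖ ≤ 2 * m → ∀ i j : ℤ, |i| + |j| ≤ n - 2 * m →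
      ∀ y ∈ kissingShell V (c + latPt i j),
        IsArrangedIn (kissingShell V (c + latPt i j + y)) fccKissingPattern ∨
          IsArrangedIn (kissingShell V (c + latPt i j + y)) hcpKissingPattern := by
    intro c m hc i j hij y hy
    refine hcp _ hy.1 ?_
    have hij' : ((|i| + |j| : ℤ) : ℝ) ≤ n - 2 * m := by exact_mod_cast hij
    calc ‖c + latPt i j + y‖ ≤ ‖c‖ + ‖latPt i j‖ + ‖y‖ := norm_add₃_le
      _ ≤ 2 * m + 2 * (|i| + |j| : ℤ) + 2 := by rw [hy.2]; linarith [norm_latPt_le i j]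
      _ ≤ 2 * n + 2 := by linarith
  -- the bases, upwards and downwards
  let bup : ℕ → (EuclideanSpace ℝ (Fin 3)) := fun m => Nat.rec (motive := fun _ => (EuclideanSpace ℝ (Fin 3))) 0
    (fun _ b => b + (((upT b : ℤ) : ℝ) • barlowOffset (2 : ℝ) + layerNormal layerSpacing)) m
  let bdn : ℕ → (EuclideanSpace ℝ (Fin 3)) := fun m => Nat.rec (motive := fun _ => (EuclideanSpace ℝ (Fin 3))) 0
    (fun _ b => b + (((dnT b : ℤ) : ℝ) • barlowOffset (2 : ℝ) - layerNormal layerSpacing)) m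
  have bup_zero : bup 0 = 0 := rfl
  have bdn_zero : bdn 0 = 0 := rfl
  have bup_succ : ∀ m, bup (m + 1) = bup m + (((upT (bup m) : ℤ) : ℝ) • barlowOffset (2 : ℝ) + layerNormal layerSpacing) := fun m => rfl
  have bdn_succ : ∀ m, bdn (m + 1) = bdn m + (((dnT (bdn m) : ℤ) : ℝ) • barlowOffset (2 : ℝ) - layerNormal layerSpacing) := fun m => rfl
  have norm_bup : ∀ m : ℕ, ‖bup m‖ ≤ 2 * m := by
    intro m
    induction m with
    | zero => simp [bup_zero]
    | succ m ih =>
      rw [bup_succ]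
      calc ‖bup m + (((upT (bup m) : ℤ) : ℝ) • barlowOffset (2 : ℝ) + layerNormal layerSpacing)‖
            ≤ ‖bup m‖ + ‖((upT (bup m) : ℤ) : ℝ) • (barlowOffset (2 : ℝ)) + layerNormal layerSpacing‖ := norm_add_le _ _
        _ ≤ 2 * m + 2 := by rw [norm_sign_smul_frameW_add_frameE (upT_sign _)]; linarith
        _ = 2 * (m + 1 : ℕ) := by push_cast; ring
  have norm_bdn : ∀ m : ℕ, ‖bdn m‖ ≤ 2 * m := by
    intro m
    induction m with
    | zero => simp [bdn_zero]
    | succ m ih =>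
      rw [bdn_succ]
      calc ‖bdn m + (((dnT (bdn m) : ℤ) : ℝ) • barlowOffset (2 : ℝ) - layerNormal layerSpacing)‖
            ≤ ‖bdn m‖ + ‖((dnT (bdn m) : ℤ) : ℝ) • (barlowOffset (2 : ℝ)) - layerNormal layerSpacing‖ := norm_add_le _ _
        _ ≤ 2 * m + 2 := by rw [norm_sign_smul_frameW_sub_frameE (dnT_sign _)]; linarith
        _ = 2 * (m + 1 : ℕ) := by push_cast; ring
  -- the invariants
  have inv_up : ∀ m : ℕ, ∃ τ' : ℝ, (τ' = 1 ∨ τ' = -1) ∧ LayerDisc V (bup m) ((upT (bup m) : ℤ) : ℝ) τ' (n - 2 * m) := by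
    intro m
    induction m with
    | zero =>
      refine ⟨σ', hσ', ?_⟩
      by_cases hn : (0 : ℤ) ≤ n
      · have e : ((upT 0 : ℤ) : ℝ) = σ := upT_eq hσ (by simpa using (hL 0 0 (by simpa using hn)).2)
        rw [bup_zero, e]; simpa using hL
      · intro i j hij; exfalso; have := abs_nonneg i; have := abs_nonneg j; push_cast at hij; omega
    | succ m ih =>
      obtain ⟨τ', hτ', hD⟩ := ih
      obtain ⟨ρ, hρ, hD'⟩ := layerDisc_up hV (upT_sign (bup m)) hD (cpAt (bup m) m (norm_bup m))
      rw [← bup_succ] at hD'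
      have e2 : n - 2 * (m : ℕ) - 2 = n - 2 * ((m + 1 : ℕ) : ℤ) := by push_cast; ring
      rw [e2] at hD'
      refine ⟨-((upT (bup m) : ℤ) : ℝ), by rcases upT_sign (bup m) with h | h <;> rw [h] <;> norm_num, ?_⟩
      by_cases hn : (0 : ℤ) ≤ n - 2 * ((m + 1 : ℕ) : ℤ)
      · have e : ((upT (bup (m + 1)) : ℤ) : ℝ) = ρ := upT_eq hρ (by simpa using (hD' 0 0 (by simpa using hn)).2)
        rwa [e]
      · intro i j hij; exfalso; have := abs_nonneg i; have := abs_nonneg j; omega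
  have inv_dn : ∀ m : ℕ, ∃ τ : ℝ, (τ = 1 ∨ τ = -1) ∧ LayerDisc V (bdn m) τ ((dnT (bdn m) : ℤ) : ℝ) (n - 2 * m) := by
    intro m
    induction m with
    | zero =>
      refine ⟨σ, hσ, ?_⟩
      by_cases hn : (0 : ℤ) ≤ n
      · have e : ((dnT 0 : ℤ) : ℝ) = σ' := dnT_eq hσ' (by simpa using (hL 0 0 (by simpa using hn)).2)
        rw [bdn_zero, e]; simpa using hL
      · intro i j hij; exfalso; have := abs_nonneg i; have := abs_nonneg j; push_cast at hij; omega
    | succ m ih =>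
      obtain ⟨τ, hτ, hD⟩ := ih
      obtain ⟨ρ', hρ', hD'⟩ := layerDisc_down hV (dnT_sign (bdn m)) hD (cpAt (bdn m) m (norm_bdn m))
      rw [← bdn_succ] at hD'
      have e2 : n - 2 * (m : ℕ) - 2 = n - 2 * ((m + 1 : ℕ) : ℤ) := by push_cast; ring
      rw [e2] at hD'
      refine ⟨-((dnT (bdn m) : ℤ) : ℝ), by rcases dnT_sign (bdn m) with h | h <;> rw [h] <;> norm_num, ?_⟩
      by_cases hn : (0 : ℤ) ≤ n - 2 * ((m + 1 : ℕ) : ℤ)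
      · have e : ((dnT (bdn (m + 1)) : ℤ) : ℝ) = ρ' := dnT_eq hρ' (by simpa using (hD' 0 0 (by simpa using hn)).2)
        rwa [e]
      · intro i j hij; exfalso; have := abs_nonneg i; have := abs_nonneg j; omega
  -- the Hägg word
  let sq : ℤ → ℤ := fun k => if 0 ≤ k then upT (bup k.toNat) else -dnT (bdn (-k - 1).toNat)
  have hsq : IsHaggSeq sq := by
    intro k
    by_cases hk : 0 ≤ k
    · simp only [sq, if_pos hk]; exact upT_int _
    · simp only [sq, if_neg hk]; rcases dnT_int (bdn (-k - 1).toNat) with h | h <;> rw [h] <;> norm_num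
  have sq_nat : ∀ m : ℕ, sq m = upT (bup m) := fun m => by
    simp only [sq, if_pos (Int.natCast_nonneg m), Int.toNat_natCast]
  have sq_neg : ∀ m : ℕ, sq (-((m : ℤ) + 1)) = -dnT (bdn m) := fun m => by
    have h1 : ¬ (0 : ℤ) ≤ -((m : ℤ) + 1) := by omega
    have h2 : (-(-((m : ℤ) + 1)) - 1).toNat = m := by simp
    simp only [sq, if_neg h1, h2]
  -- positions of the bases
  have up_pos : ∀ m : ℕ, bup m = (haggLabel sq m : ℝ) • (barlowOffset (2 : ℝ)) + ((m : ℤ) : ℝ) • layerNormal layerSpacing := by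
    intro m
    induction m with
    | zero => simp [bup_zero]
    | succ m ih =>
      rw [bup_succ]
      set ν := upT (bup m) with hν
      rw [ih, Nat.cast_succ, haggLabel_succ, sq_nat m, ← hν]
      push_cast
      module
  have dn_pos : ∀ m : ℕ, bdn m = (haggLabel sq (-(m : ℤ)) : ℝ) • (barlowOffset (2 : ℝ)) + ((-(m : ℤ) : ℤ) : ℝ) • layerNormal layerSpacing := by
    intro m
    induction m with
    | zero => simp [bdn_zero]
    | succ m ih =>
      have hrec : haggLabel sq (-(m : ℤ)) = haggLabel sq (-((m : ℤ) + 1)) + sq (-((m : ℤ) + 1)) := by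
        have := haggLabel_succ sq (-((m : ℤ) + 1))
        rwa [show -((m : ℤ) + 1) + 1 = -(m : ℤ) by ring] at this
      rw [bdn_succ]
      set ν := dnT (bdn m) with hν
      rw [ih]
      have e : (haggLabel sq (-((m + 1 : ℕ) : ℤ)) : ℝ) = haggLabel sq (-(m : ℤ)) + ν := by
        rw [Nat.cast_succ, hrec, sq_neg m, ← hν]; push_cast; ring
      rw [e]
      push_cast
      module
  -- conclusion
  refine ⟨sq, hsq, fun k i j hk => ?_⟩
  rcases le_or_gt 0 k with hk0 | hk0
  · obtain ⟨m, rfl⟩ := Int.eq_ofNat_of_zero_le hk0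
    obtain ⟨τ', -, hD⟩ := inv_up m
    have h := (hD i j (by rwa [abs_of_nonneg hk0] at hk)).1
    rw [up_pos m] at h
    rw [barlowPos_eq_latPt, add_comm]
    exact h
  · obtain ⟨m, rfl⟩ : ∃ m : ℕ, k = -((m : ℤ) + 1) := ⟨(-k - 1).toNat, by omega⟩
    obtain ⟨τ, -, hD⟩ := inv_dn (m + 1)
    have hk' : |i| + |j| ≤ n - 2 * ((m + 1 : ℕ) : ℤ) := by
      rw [abs_of_neg hk0] at hk; push_cast at hk ⊢; linarith
    have h := (hD i j hk').1
    rw [dn_pos (m + 1)] at h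
    rw [barlowPos_eq_latPt, add_comm]
    convert h using 3 <;> push_cast <;> ring_nf

end Summit.Ventures.Crystal3D.Theorems.LocalStacking

end
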